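import Mathlib
import HarnessLib

/-!
# Every valuation ring of `L` containing `V₀ ⊆ K` contains an EXTENSION of `V₀`; hence the intersection
# of the extensions of `V₀` is the integral closure of `V₀` in `L`
# (crux `WildQuotients.WildQuotientResolution`, stub `stub_phaseZeroHighDim`: step (P8'a) of the port of (H1))

Crux stmt-ResolutionOfSingularities-15640 (`WildQuotientResolution`), registered stub `stub_phaseZeroHighDim`,
residual (H1) = Abbes–Saito 2011 Prop. 2.22. In the Zariski-local form of its Lemma 2.21 (evidence memo
PHASE0-H1-PORTPLAN.md §2b; terminal step ✓`CentreInertia.hasNormalSylow_of_centre`) the ring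
`B = ⋂ {W' : W' ∩ K = V₀}` of all extensions of a valuation ring `V₀` of `K` to the extension field `L` has
to be identified with the INTEGRAL CLOSURE of `V₀` in `L` (the stalks of relative normalisations are integral
closures). Mathlib knows that the integral closure of a subset `s ⊆ L` is the intersection of ALL valuation
subrings of `L` containing `s` (`iInf_valuationSubring_superset`); this file supplies the missing
valuation-theoretic step ("going down" for valuation rings, Zariski–Samuel VI §7; Bourbaki AC VI §8):

* `exists_extension_le` — **every valuation subring `V` of `L` containing (the image of) `V₀` contains a
  valuation subring `W ≤ V` with `W ∩ K = V₀`.** Proof: `R = {y ∈ L : y ≡ a (mod 𝔪_V) for some a ∈ V₀}`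
  is a LOCAL subring of `V` (a residue class modulo `𝔪_V` of a unit of `V₀` consists of units of `R`); by
  Chevalley (Mathlib `LocalSubring.exists_le_valuationSubring`) some valuation ring `W` of `L` dominates `R`;
  then `W ≤ V` (an element of `W` outside `V` has its inverse in `𝔪_V ⊆ 𝔪_R ⊆ 𝔪_W`) and `W ∩ K = V₀`
  (`W ∩ K ⊇ V₀` dominantly).
* `forall_mem_of_forall_mem_extension` — so an element lying in every extension of `V₀` lies in every
  valuation subring containing `V₀`; `mem_integralClosure_of_forall_mem_extension` — hence is integral over
  (the subring generated by) `V₀`, by Mathlib's `iInf_valuationSubring_superset`; and conversely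
  `mem_extension_of_isIntegral`.

[OURS · crux stmt-ResolutionOfSingularities-15640 · helper toward `stub_phaseZeroHighDim` (step P8'a of the port of
the named fact (H1); NOT a proof of the stub); counted 0; AI-level work, weaker than expert review.]
[cite: ZariskiSamuel1960, Ch. VI §7] [cite: BourbakiAC5to7, Ch. VI §8] [folklore]
-/

-- single-problem summit: the doubled namespace component `ResolutionOfSingularities` is forced
set_option linter.dupNamespace false

noncomputable section

namespace Summit.ResolutionOfSingularities.ResolutionOfSingularities.Theorems.WildQuotientResolution.ExtensionBelow

universe u

variable {K L : Type u} [Field K] [Field L] [Algebra K L]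

/-- The subring `R = {y ∈ L : y ≡ a (mod 𝔪_V) for some a ∈ V₀}` of `V` (the preimage in `V` of the image of
`V₀` in the residue field of `V`). [folklore] -/
theorem exists_subring_congr (V₀ : ValuationSubring K) (V : ValuationSubring L)
    (hV : ∀ a ∈ V₀, algebraMap K L a ∈ V) :
    ∃ R : Subring L, ∀ y : L, y ∈ R ↔ ∃ a ∈ V₀, V.valuation (y - algebraMap K L a) < 1 := by
  have hle1 : ∀ a ∈ V₀, V.valuation (algebraMap K L a) ≤ 1 := fun a ha =>
    (V.valuation_le_one_iff _).mpr (hV a ha)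
  refine ⟨{ carrier := {y | ∃ a ∈ V₀, V.valuation (y - algebraMap K L a) < 1},
             mul_mem' := ?_, one_mem' := ?_, add_mem' := ?_, zero_mem' := ?_, neg_mem' := ?_ },
    fun y => Iff.rfl⟩
  · rintro y y' ⟨a, ha, hy⟩ ⟨a', ha', hy'⟩
    refine ⟨a * a', mul_mem ha ha', ?_⟩
    have hyV : V.valuation y ≤ 1 := by
      have : y = (y - algebraMap K L a) + algebraMap K L a := by ring
      rw [this]
      exact Valuation.map_add_le _ hy.le (hle1 a ha)
    have : y * y' - algebraMap K L (a * a') =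
        y * (y' - algebraMap K L a') + algebraMap K L a' * (y - algebraMap K L a) := by
      rw [map_mul]; ring
    rw [this]
    refine Valuation.map_add_lt _ ?_ ?_
    · rw [map_mul]
      calc V.valuation y * V.valuation (y' - algebraMap K L a') ≤ 1 * V.valuation (y' - algebraMap K L a') :=
            by gcongr
        _ < 1 := by rw [one_mul]; exact hy'
    · rw [map_mul]
      calc V.valuation (algebraMap K L a') * V.valuation (y - algebraMap K L a)
          ≤ 1 * V.valuation (y - algebraMap K L a) := by gcongr; exact hle1 a' ha'
        _ < 1 := by rw [one_mul]; exact hy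
  · exact ⟨1, one_mem _, by rw [map_one, sub_self, map_zero]; exact zero_lt_one⟩
  · rintro y y' ⟨a, ha, hy⟩ ⟨a', ha', hy'⟩
    refine ⟨a + a', add_mem ha ha', ?_⟩
    have : y + y' - algebraMap K L (a + a') = (y - algebraMap K L a) + (y' - algebraMap K L a') := by
      rw [map_add]; ring
    rw [this]
    exact Valuation.map_add_lt _ hy hy'
  · exact ⟨0, zero_mem _, by rw [map_zero, sub_self, map_zero]; exact zero_lt_one⟩
  · rintro y ⟨a, ha, hy⟩
    refine ⟨-a, neg_mem ha, ?_⟩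
    have : -y - algebraMap K L (-a) = -(y - algebraMap K L a) := by rw [map_neg]; ring
    rw [this, Valuation.map_neg]
    exact hy

/-- A non-zero element of a subring of a field whose inverse also lies in the subring is a unit. [folklore] -/
theorem isUnit_of_inv_mem {S : Subring L} {y : L} (hy : y ∈ S) (hy0 : y ≠ 0) (hyi : y⁻¹ ∈ S) :
    IsUnit (⟨y, hy⟩ : S) :=
  isUnit_iff_exists_inv.mpr ⟨⟨y⁻¹, hyi⟩, Subtype.ext (mul_inv_cancel₀ hy0)⟩

/-- The inverse of a unit of a subring of a field lies in the subring. [folklore] -/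
theorem inv_mem_of_isUnit {S : Subring L} {y : L} (hy : y ∈ S) (h : IsUnit (⟨y, hy⟩ : S)) : y⁻¹ ∈ S := by
  obtain ⟨⟨z, hz⟩, e⟩ := isUnit_iff_exists_inv.mp h
  have hyz : y * z = 1 := congrArg Subtype.val e
  rw [inv_eq_of_mul_eq_one_right hyz]
  exact hz

/-- An element of a valuation ring whose inverse is also in it has valuation `1`. [folklore] -/
theorem valuation_eq_one_of_inv_mem (V : ValuationSubring L) {y : L} (hy : y ∈ V) (hy0 : y ≠ 0)
    (hyi : y⁻¹ ∈ V) : V.valuation y = 1 :=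
  (V.valuation_eq_one_iff ⟨y, hy⟩).mp (isUnit_of_inv_mem (S := V.toSubring) hy hy0 hyi)

/-- **Going down for valuation rings**: every valuation subring `V` of `L` containing the image of a
valuation subring `V₀` of `K` contains a valuation subring `W ≤ V` of `L` with `W ∩ K = V₀` (`W` = a
valuation ring dominating the local ring of elements of `V` congruent modulo `𝔪_V` to an element of `V₀`).
[cite: ZariskiSamuel1960, Ch. VI §7] [cite: BourbakiAC5to7, Ch. VI §8] -/
theorem exists_extension_le (V₀ : ValuationSubring K) (V : ValuationSubring L)
    (hV : ∀ a ∈ V₀, algebraMap K L a ∈ V) :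
    ∃ W : ValuationSubring L, W ≤ V ∧ W.comap (algebraMap K L) = V₀ := by
  have hle1 : ∀ a ∈ V₀, V.valuation (algebraMap K L a) ≤ 1 := fun a ha =>
    (V.valuation_le_one_iff _).mpr (hV a ha)
  obtain ⟨R, hR⟩ := exists_subring_congr V₀ V hV
  -- `R ≤ V`, `V₀ ⊆ R`
  have hRV : ∀ y ∈ R, y ∈ V := by
    intro y hy
    obtain ⟨a, ha, hya⟩ := (hR y).mp hy
    have : y = algebraMap K L a + (y - algebraMap K L a) := by ring
    rw [← V.valuation_le_one_iff, this]
    exact Valuation.map_add_le _ (hle1 a ha) hya.le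
  have halg : ∀ a ∈ V₀, algebraMap K L a ∈ R := fun a ha =>
    (hR _).mpr ⟨a, ha, by rw [sub_self, map_zero]; exact zero_lt_one⟩
  -- a residue class of a unit of `V₀` consists of invertible elements of `R`
  have hunit : ∀ (y : L) (a : K), a ∈ V₀ → a⁻¹ ∈ V₀ → a ≠ 0 →
      V.valuation (y - algebraMap K L a) < 1 → y ≠ 0 ∧ y⁻¹ ∈ R := by
    intro y a ha hai ha0 hya
    have hα0 : algebraMap K L a ≠ 0 := (map_ne_zero _).mpr ha0
    have hva : V.valuation (algebraMap K L a) = 1 :=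
      valuation_eq_one_of_inv_mem V (hV a ha) hα0 (by rw [← map_inv₀]; exact hV _ hai)
    have hvy : V.valuation y = 1 := by
      have : y = algebraMap K L a + (y - algebraMap K L a) := by ring
      rw [this, Valuation.map_add_eq_of_lt_left _ (by rw [hva]; exact hya), hva]
    have hy0 : y ≠ 0 := fun h => by rw [h, map_zero] at hvy; exact zero_ne_one hvy
    refine ⟨hy0, (hR _).mpr ⟨a⁻¹, hai, ?_⟩⟩
    have : y⁻¹ - algebraMap K L a⁻¹ = (algebraMap K L a - y) * (y⁻¹ * (algebraMap K L a)⁻¹) := by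
      rw [map_inv₀]; field_simp
    rw [this, Valuation.map_mul, Valuation.map_mul, map_inv₀, map_inv₀, hvy, hva, inv_one, mul_one,
      mul_one, Valuation.map_sub_swap]
    exact hya
  -- `R` is local
  have hloc : IsLocalRing R := by
    refine IsLocalRing.of_isUnit_or_isUnit_one_sub_self fun y => ?_
    obtain ⟨a, ha, hya⟩ := (hR y).mp y.2
    rcases IsLocalRing.isUnit_or_isUnit_one_sub_self (⟨a, ha⟩ : V₀) with hu | hu
    · have hai : a⁻¹ ∈ V₀ := inv_mem_of_isUnit (S := V₀.toSubring) ha hu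
      have ha0 : a ≠ 0 := by
        rintro rfl
        exact not_isUnit_zero ((show (⟨(0 : K), ha⟩ : V₀) = 0 from Subtype.ext rfl) ▸ hu)
      obtain ⟨hy0, hyi⟩ := hunit y a ha hai ha0 hya
      exact Or.inl (isUnit_of_inv_mem y.2 hy0 hyi)
    · have h1a : (1 - a) ∈ V₀ := sub_mem (one_mem _) ha
      have hu' : IsUnit (⟨1 - a, h1a⟩ : V₀) := hu
      have hai : (1 - a)⁻¹ ∈ V₀ := inv_mem_of_isUnit (S := V₀.toSubring) h1a hu'
      have ha0 : 1 - a ≠ 0 := by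
        intro h
        have h0 : (⟨1 - a, h1a⟩ : V₀) = 0 := Subtype.ext h
        rw [h0] at hu'
        exact not_isUnit_zero hu'
      have hya' : V.valuation (((1 : L) - y) - algebraMap K L (1 - a)) < 1 := by
        rw [map_sub (algebraMap K L), map_one, show (1 : L) - (y : L) - (1 - algebraMap K L a) =
          -((y : L) - algebraMap K L a) by ring, Valuation.map_neg]
        exact hya
      obtain ⟨hy0, hyi⟩ := hunit _ _ h1a hai ha0 hya'
      exact Or.inr (isUnit_of_inv_mem (sub_mem (one_mem _) y.2) hy0 hyi)
  -- Chevalley: a valuation ring `W` dominating `R`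
  haveI := hloc
  obtain ⟨W, hW⟩ := (LocalSubring.mk R).exists_le_valuationSubring
  obtain ⟨hRW, hlocHom⟩ := LocalSubring.le_def.mp hW
  have hRW' : ∀ r ∈ R, r ∈ W := fun r hr => hRW hr
  have hdom : ∀ (r : L) (hr : r ∈ R), r ≠ 0 → r⁻¹ ∈ W → r⁻¹ ∈ R := by
    intro r hr hr0 hri
    have hu : IsUnit (Subring.inclusion hRW ⟨r, hr⟩) :=
      isUnit_of_inv_mem (S := W.toSubring) (hRW' r hr) hr0 hri
    exact inv_mem_of_isUnit hr (hlocHom.map_nonunit _ hu)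
  refine ⟨W, fun w hw => ?_, ?_⟩
  · -- `W ≤ V`
    by_contra hwV
    have hw0 : w ≠ 0 := fun h => hwV (h ▸ zero_mem V)
    have hwi : w⁻¹ ∈ V := (V.mem_or_inv_mem w).resolve_left hwV
    have hvwi : V.valuation w⁻¹ < 1 := by
      refine lt_of_le_of_ne ((V.valuation_le_one_iff _).mpr hwi) fun h => hwV ?_
      have := inv_mem_of_isUnit (S := V.toSubring) hwi ((V.valuation_eq_one_iff ⟨w⁻¹, hwi⟩).mpr h)
      rwa [inv_inv] at this
    have hwiR : w⁻¹ ∈ R := (hR _).mpr ⟨0, zero_mem _, by rwa [map_zero, sub_zero]⟩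
    have : w⁻¹⁻¹ ∈ R := hdom w⁻¹ hwiR (inv_ne_zero hw0) (by rw [inv_inv]; exact hw)
    rw [inv_inv] at this
    exact hwV (hRV w this)
  · -- `W ∩ K = V₀`
    ext c
    rw [ValuationSubring.mem_comap]
    refine ⟨fun hc => ?_, fun hc => hRW' _ (halg c hc)⟩
    by_contra hcV
    have hc0 : c ≠ 0 := fun h => hcV (h ▸ zero_mem V₀)
    have hci : c⁻¹ ∈ V₀ := (V₀.mem_or_inv_mem c).resolve_left hcV
    have hciR : algebraMap K L c⁻¹ ∈ R := halg _ hci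
    have h1 : (algebraMap K L c⁻¹)⁻¹ ∈ R :=
      hdom _ hciR (by rw [map_inv₀]; exact inv_ne_zero ((map_ne_zero _).mpr hc0))
        (by rw [map_inv₀, inv_inv]; exact hc)
    rw [map_inv₀, inv_inv] at h1
    obtain ⟨a, ha, hca⟩ := (hR _).mp h1
    have hd : c - a ∉ V₀ := fun h => hcV (by simpa using add_mem h ha)
    have hd0 : c - a ≠ 0 := fun h => hd (h ▸ zero_mem V₀)
    have hdi : (c - a)⁻¹ ∈ V₀ := (V₀.mem_or_inv_mem _).resolve_left hd
    have hlt : V.valuation (algebraMap K L (c - a)) < 1 := by rw [map_sub (algebraMap K L)]; exact hca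
    have heq : V.valuation (algebraMap K L (c - a)) = 1 :=
      valuation_eq_one_of_inv_mem V ((V.valuation_le_one_iff _).mp hlt.le)
        ((map_ne_zero _).mpr hd0) (by rw [← map_inv₀]; exact hV _ hdi)
    rw [heq] at hlt
    exact lt_irrefl _ hlt

/-- **An element lying in every extension of `V₀` lies in every valuation ring containing `V₀`.**
[cite: ZariskiSamuel1960, Ch. VI §7] -/
theorem forall_mem_of_forall_mem_extension (V₀ : ValuationSubring K) {x : L}
    (hx : ∀ W : ValuationSubring L, W.comap (algebraMap K L) = V₀ → x ∈ W)
    (V : ValuationSubring L) (hV : ∀ a ∈ V₀, algebraMap K L a ∈ V) : x ∈ V := by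
  obtain ⟨W, hWV, hW⟩ := exists_extension_le V₀ V hV
  exact hWV (hx W hW)

/-- **The intersection of the extensions of `V₀` is integral over `V₀`**: an element of `L` lying in every
valuation subring `W` of `L` with `W ∩ K = V₀` is integral over the subring of `L` generated by (the image of)
`V₀` — through Mathlib's `iInf_valuationSubring_superset` (the integral closure of a subset is the
intersection of the valuation subrings containing it). [cite: ZariskiSamuel1960, Ch. VI §4, Thm. 6; §7] -/
theorem mem_integralClosure_of_forall_mem_extension (V₀ : ValuationSubring K) {x : L}
    (hx : ∀ W : ValuationSubring L, W.comap (algebraMap K L) = V₀ → x ∈ W) :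
    x ∈ integralClosure (Subring.closure (algebraMap K L '' (V₀ : Set K))) L := by
  have h : x ∈ (⨅ V : {V : ValuationSubring L // algebraMap K L '' (V₀ : Set K) ⊆ V.toSubring},
      V.1.toSubring) := by
    rw [Subring.mem_iInf]
    rintro ⟨V, hV⟩
    exact forall_mem_of_forall_mem_extension V₀ hx V fun a ha => hV ⟨a, ha, rfl⟩
  rw [iInf_valuationSubring_superset] at h
  exact h

/-- Conversely, **an element integral over `V₀` lies in every extension of `V₀`** (valuation rings are
integrally closed). [folklore] -/
theorem mem_extension_of_isIntegral (V₀ : ValuationSubring K) {x : L}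
    (hx : x ∈ integralClosure (Subring.closure (algebraMap K L '' (V₀ : Set K))) L)
    (W : ValuationSubring L) (hW : W.comap (algebraMap K L) = V₀) : x ∈ W := by
  have h : x ∈ (⨅ V : {V : ValuationSubring L // algebraMap K L '' (V₀ : Set K) ⊆ V.toSubring},
      V.1.toSubring) := by
    rw [iInf_valuationSubring_superset]; exact hx
  rw [Subring.mem_iInf] at h
  refine h ⟨W, ?_⟩
  rintro _ ⟨a, ha, rfl⟩
  change algebraMap K L a ∈ W
  rw [← ValuationSubring.mem_comap, hW]
  exact ha

end Summit.ResolutionOfSingularities.ResolutionOfSingularities.Theorems.WildQuotientResolution.ExtensionBelow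

end
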